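import Summits.HodgeConjecture.HodgeCM.Automorphic.SchwartzStoneVonNeumann_2

/-! PORT of `HodgeCM/Automorphic/SchwartzStoneVonNeumann.lean` (HodgeCMPerL run 82) — part 3: continuation of `Summits.HodgeConjecture.HodgeCM.Automorphic.SchwartzStoneVonNeumann_2` (split at a top-level declaration boundary by port_pkg.py; scope re-opened below; declarations unchanged). -/

-- port_pkg: scope re-opened for this part (file-level context, then the namespace/section stack open at the cut)
noncomputable section
set_option maxSynthPendingDepth 2
open MeasureTheory Filter Set Metric Function intervalIntegral
open scoped RealInnerProductSpace FourierTransform SchwartzMap Topology ContDiff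
namespace HodgeCM
namespace SchwartzWeil
section Functional
variable {V : Type*} [NormedAddCommGroup V] [InnerProductSpace ℝ V] [FiniteDimensional ℝ V]
  [MeasurableSpace V] [BorelSpace V]
open SvN
/-- A modulation-invariant continuous linear functional vanishes on `{Φ : Φ 0 = 0}`. -/
theorem apply_eq_zero_of_comp_modCLM (u : 𝓢(V, ℂ) →L[ℂ] ℂ) (hu : ∀ c : V, u.comp (modCLM V c) = u)
    (f : 𝓢(V, ℂ)) (hf : f 0 = 0) : u f = 0 := by
  -- compactly supported `φ` with `φ 0 = 0`, by Hadamard's lemma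
  have hcpt : ∀ φ : 𝓢(V, ℂ), HasCompactSupport (φ : V → ℂ) → φ 0 = 0 → u φ = 0 := by
    intro φ hφc hφ0
    obtain ⟨s, hss, hsc, hsum⟩ := hadamard_sum (stdOrthonormalBasis ℝ V) (φ.smooth ⊤) hφc hφ0
    have hφ : φ = ∑ i, coordMul (stdOrthonormalBasis ℝ V i) ((hsc i).toSchwartzMap (hss i)) := by
      ext x
      rw [hsum x, sum_apply]
      exact Finset.sum_congr rfl fun i _ => by rw [coordMul_apply]; rfl
    rw [hφ, map_sum]
    exact Finset.sum_eq_zero fun i _ => apply_coordMul_eq_zero_of_comp_modCLM u hu _ _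
  obtain ⟨v, hvc, hv0, hvt⟩ := exists_hasCompactSupport_tendsto f
  have h1 : Tendsto (fun m => u (v m)) atTop (𝓝 (u f)) := u.continuous.continuousAt.tendsto.comp hvt
  have h2 : (fun m => u (v m)) = fun _ => 0 := funext fun m => hcpt (v m) (hvc m) (hv0 m 0 hf)
  rw [h2] at h1
  exact tendsto_nhds_unique h1 tendsto_const_nhds

omit [MeasurableSpace V] [BorelSpace V] in
/-- A Schwartz function with `Φ 0 = 1` (a bump). -/
theorem exists_schwartz_apply_zero_eq_one : ∃ Φ : 𝓢(V, ℂ), Φ 0 = 1 := by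
  let χ : ContDiffBump (0 : V) := ⟨1, 2, one_pos, one_lt_two⟩
  have hs : HasCompactSupport (fun x => (χ x : ℂ)) := χ.hasCompactSupport.comp_left Complex.ofReal_zero
  have hd : ContDiff ℝ ∞ (fun x => (χ x : ℂ)) := Complex.ofRealCLM.contDiff.comp χ.contDiff
  refine ⟨hs.toSchwartzMap hd, ?_⟩
  change ((χ 0 : ℝ) : ℂ) = 1
  rw [χ.one_of_mem_closedBall (Metric.mem_closedBall_self one_pos.le), Complex.ofReal_one]

/-- **Modulation-invariant functionals are multiples of `δ₀`.**  A continuous linear functional `u` on `𝓢(V, ℂ)`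
with `u ∘ M_c = u` for all `c : V` satisfies `u Φ = κ Φ(0)` for a constant `κ`. -/
theorem exists_eq_const_mul_eval_of_comp_modCLM (u : 𝓢(V, ℂ) →L[ℂ] ℂ)
    (hu : ∀ c : V, u.comp (modCLM V c) = u) : ∃ κ : ℂ, ∀ f : 𝓢(V, ℂ), u f = κ * f 0 := by
  obtain ⟨Φ, hΦ⟩ := exists_schwartz_apply_zero_eq_one (V := V)
  refine ⟨u Φ, fun f => ?_⟩
  have h : u (f - (f 0) • Φ) = 0 :=
    apply_eq_zero_of_comp_modCLM u hu _ (by simp [hΦ])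
  rw [map_sub, map_smul, sub_eq_zero, smul_eq_mul] at h
  rw [h, mul_comm]

end Functional

/-! ## Part C. Schur's lemma: operators commuting with translations and modulations are scalars -/

section Operator

variable {V : Type*} [NormedAddCommGroup V] [InnerProductSpace ℝ V] [FiniteDimensional ℝ V]
  [MeasurableSpace V] [BorelSpace V]

open SvN

/-- **Schur's lemma for the Schrödinger representation on `𝓢(V, ℂ)` (smooth Stone–von Neumann rigidity).**
A continuous `ℂ`-linear operator on Schwartz space commuting with every translation `τ_a` and every modulation
`M_b` is a scalar multiple of the identity. -/
theorem exists_eq_smul_id_of_commute (A : 𝓢(V, ℂ) →L[ℂ] 𝓢(V, ℂ))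
    (hτ : ∀ a : V, A.comp (SchwartzMap.compSubConstCLM ℂ a) = (SchwartzMap.compSubConstCLM ℂ a).comp A)
    (hM : ∀ b : V, A.comp (modCLM V b) = (modCLM V b).comp A) :
    ∃ κ : ℂ, A = κ • ContinuousLinearMap.id ℂ 𝓢(V, ℂ) := by
  -- the functional `Φ ↦ (A Φ)(0)` is modulation invariant
  set u : 𝓢(V, ℂ) →L[ℂ] ℂ := (evalZero V).comp A with hu_def
  have hu : ∀ c : V, u.comp (modCLM V c) = u := by
    intro c
    ext f
    have h := congrArg (fun T : 𝓢(V, ℂ) →L[ℂ] 𝓢(V, ℂ) => T f 0) (hM c)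
    simp only [ContinuousLinearMap.comp_apply, modCLM_apply, inner_zero_right, AddChar.map_zero_eq_one,
      Circle.coe_one, one_mul] at h
    simpa [hu_def] using h
  obtain ⟨κ, hκ⟩ := exists_eq_const_mul_eval_of_comp_modCLM u hu
  refine ⟨κ, ?_⟩
  ext f x
  -- transport `(A Φ)(0) = κ Φ(0)` to the point `x` with the translation `τ_{-x}`
  have h := congrArg (fun T : 𝓢(V, ℂ) →L[ℂ] 𝓢(V, ℂ) => T f 0) (hτ (-x))
  simp only [ContinuousLinearMap.comp_apply, SchwartzMap.compSubConstCLM_apply, sub_neg_eq_add, zero_add] at h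
  have h' := hκ (SchwartzMap.compSubConstCLM ℂ (-x) f)
  simp only [hu_def, ContinuousLinearMap.comp_apply, evalZero_apply, SchwartzMap.compSubConstCLM_apply,
    sub_neg_eq_add, zero_add] at h'
  rw [← h, h']
  simp

/-- A version with the hypotheses stated on vectors. -/
theorem exists_eq_smul_id_of_commute' (A : 𝓢(V, ℂ) →L[ℂ] 𝓢(V, ℂ))
    (hτ : ∀ (a : V) (Φ : 𝓢(V, ℂ)), A (SchwartzMap.compSubConstCLM ℂ a Φ) = SchwartzMap.compSubConstCLM ℂ a (A Φ))
    (hM : ∀ (b : V) (Φ : 𝓢(V, ℂ)), A (modCLM V b Φ) = modCLM V b (A Φ)) :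
    ∃ κ : ℂ, ∀ Φ : 𝓢(V, ℂ), A Φ = κ • Φ := by
  obtain ⟨κ, hκ⟩ := exists_eq_smul_id_of_commute A (fun a => by ext Φ x; simp [hτ])
    (fun b => by ext Φ x; simp [hM])
  exact ⟨κ, fun Φ => by rw [hκ]; rfl⟩

end Operator

/-! ## Part D. The commutant of the Schrödinger representation of `Heis V` and uniqueness of intertwiners -/

section Heisenberg

variable {V : Type} [NormedAddCommGroup V] [InnerProductSpace ℝ V] [FiniteDimensional ℝ V]
  [MeasurableSpace V] [BorelSpace V] {m : ℤ}

/-- `ρ_m(a, 0, 1) = τ_a`. -/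
theorem repCLM_translation (m : ℤ) (a : V) : repCLM V m ⟨a, 0, 1⟩ = SchwartzMap.compSubConstCLM ℂ a := by
  ext Φ x
  simp only [repCLM_apply, Circle.coe_one, one_zpow, smul_zero, inner_zero_left, AddChar.map_zero_eq_one,
    Circle.coe_one, one_mul, SchwartzMap.compSubConstCLM_apply]

/-- `ρ_m(0, b/m, 1) = M_b` for `m ≠ 0`. -/
theorem repCLM_modulation (hm : m ≠ 0) (b : V) : repCLM V m ⟨0, ((m : ℝ)⁻¹) • b, 1⟩ = modCLM V b := by
  have hm' : (m : ℝ) ≠ 0 := by exact_mod_cast hm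
  ext Φ x
  simp only [repCLM_apply, Circle.coe_one, one_zpow, one_mul, smul_smul, mul_inv_cancel₀ hm', one_smul,
    sub_zero, modCLM_apply]

/-- **The commutant of the weight-`m` Schrödinger representation (`m ≠ 0`) on `𝓢(V, ℂ)` is `ℂ • id`.** -/
theorem exists_eq_smul_id_of_commute_repCLM (hm : m ≠ 0) (A : 𝓢(V, ℂ) →L[ℂ] 𝓢(V, ℂ))
    (hA : ∀ h : Heis V, A.comp (repCLM V m h) = (repCLM V m h).comp A) :
    ∃ κ : ℂ, A = κ • ContinuousLinearMap.id ℂ 𝓢(V, ℂ) := by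
  refine exists_eq_smul_id_of_commute A (fun a => ?_) (fun b => ?_)
  · simpa only [repCLM_translation] using hA ⟨a, 0, 1⟩
  · simpa only [repCLM_modulation hm] using hA ⟨0, ((m : ℝ)⁻¹) • b, 1⟩

/-- **Schur's lemma, idempotent form**: a continuous idempotent commuting with `ρ_m` (`m ≠ 0`) is `0` or `id` — there is
no non-trivial `ρ_m`-invariant complemented closed subspace of `𝓢(V, ℂ)`. -/
theorem idempotent_commute_repCLM_eq_zero_or_id (hm : m ≠ 0) (P : 𝓢(V, ℂ) →L[ℂ] 𝓢(V, ℂ))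
    (hP : P.comp P = P) (hA : ∀ h : Heis V, P.comp (repCLM V m h) = (repCLM V m h).comp P) :
    P = 0 ∨ P = ContinuousLinearMap.id ℂ 𝓢(V, ℂ) := by
  obtain ⟨κ, hκ⟩ := exists_eq_smul_id_of_commute_repCLM hm P hA
  obtain ⟨Φ, hΦ⟩ := exists_schwartz_apply_zero_eq_one (V := V)
  have hPΦ : ∀ Ψ : 𝓢(V, ℂ), P Ψ = κ • Ψ := fun Ψ => by rw [hκ]; rfl
  have h1 : P (P Φ) = P Φ := by rw [← ContinuousLinearMap.comp_apply, hP]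
  rw [hPΦ Φ, map_smul, hPΦ Φ, smul_smul] at h1
  have h2 := congrArg (fun g : 𝓢(V, ℂ) => g 0) h1
  simp only [smul_apply, smul_eq_mul, hΦ, mul_one] at h2
  by_cases hκ0 : κ = 0
  · left; rw [hκ, hκ0, zero_smul]
  · right
    have hκ1 : κ = 1 := mul_left_cancel₀ hκ0 (h2.trans (mul_one κ).symm)
    rw [hκ, hκ1, one_smul]

/-- **Uniqueness of intertwiners up to a scalar.**  Let `γ` be any self-map of `Heis V` and `m ≠ 0`.  If a continuous
operator `A` and a continuous automorphism `B` of `𝓢(V, ℂ)` both satisfy the intertwining relation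
`X ∘ ρ_m(h) = ρ_m(γ h) ∘ X` for all `h`, then `A = κ • B` for a constant `κ`. -/
theorem intertwiner_unique_repCLM (hm : m ≠ 0) (γ : Heis V → Heis V)
    (A : 𝓢(V, ℂ) →L[ℂ] 𝓢(V, ℂ)) (B : 𝓢(V, ℂ) ≃L[ℂ] 𝓢(V, ℂ))
    (hA : ∀ h : Heis V, A.comp (repCLM V m h) = (repCLM V m (γ h)).comp A)
    (hB : ∀ h : Heis V, (B : 𝓢(V, ℂ) →L[ℂ] 𝓢(V, ℂ)).comp (repCLM V m h) =
      (repCLM V m (γ h)).comp (B : 𝓢(V, ℂ) →L[ℂ] 𝓢(V, ℂ))) :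
    ∃ κ : ℂ, A = κ • (B : 𝓢(V, ℂ) →L[ℂ] 𝓢(V, ℂ)) := by
  set C : 𝓢(V, ℂ) →L[ℂ] 𝓢(V, ℂ) := (B.symm : 𝓢(V, ℂ) →L[ℂ] 𝓢(V, ℂ)).comp A with hC
  have hC' : ∀ h : Heis V, C.comp (repCLM V m h) = (repCLM V m h).comp C := by
    intro h
    ext f x
    have h1 := congrArg (fun T : 𝓢(V, ℂ) →L[ℂ] 𝓢(V, ℂ) => T f) (hA h)
    have h2 := congrArg (fun T : 𝓢(V, ℂ) →L[ℂ] 𝓢(V, ℂ) => T (B.symm (A f))) (hB h)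
    simp only [ContinuousLinearMap.comp_apply, ContinuousLinearEquiv.coe_coe,
      ContinuousLinearEquiv.apply_symm_apply] at h1 h2
    simp only [hC, ContinuousLinearMap.comp_apply, ContinuousLinearEquiv.coe_coe, h1, ← h2,
      ContinuousLinearEquiv.symm_apply_apply]
  obtain ⟨κ, hκ⟩ := exists_eq_smul_id_of_commute_repCLM hm C hC'
  refine ⟨κ, ?_⟩
  ext f x
  have h := congrArg (fun T : 𝓢(V, ℂ) →L[ℂ] 𝓢(V, ℂ) => B (T f) x) hκ
  simp only [hC, ContinuousLinearMap.comp_apply, ContinuousLinearEquiv.coe_coe, ContinuousLinearEquiv.apply_symm_apply,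
    smul_apply, ContinuousLinearMap.id_apply, map_smul] at h
  simpa using h

end Heisenberg

end SchwartzWeil
end HodgeCM

end
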